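import Literature.NumberTheory.EllipticCurves.Milne1972.WeilRestrictionQuadraticBSDQuotientAnyModel
import Literature.NumberTheory.EllipticCurves.ComplexMultiplicationBurungaleFlachProofs
import Literature.NumberTheory.DiophantineGeometry.EllArithGlue
import Literature.NumberTheory.DiophantineGeometry.MinimalDiscriminantNormProofs
import Literature.NumberTheory.EllipticCurves.BSDQuadraticDescentTorsionOddPartProofs
import HarnessLib

/-!
# The globally-minimal-model form of Milne's Weil-restriction identity IS the any-model form
# specialised (proofs companion of `Milne1972/WeilRestrictionQuadraticBSDQuotient{,AnyModel}`)

Topic `NumberTheory/EllipticCurves`, story `Milne1972`. PROOF file (theorems only; no definition, no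
named fact, nothing asserted — D-0026) relating the two named facts of this story BY NAME:

* `Literature.NumberTheory.EllipticCurves.Milne1972.bsdQuotient_baseChange_quadratic_anyModel`
  (registry A73): for `W/ℚ` globally minimal, `K` quadratic, `Wd` a globally minimal model of
  `W^{(d_K)}` and ANY `K`-model `V` of `W_K`, finiteness of `Ш(W)`, `Ш(Wd)` gives finiteness of `Ш(V)`
  and `#Ш(V)·Reg(V)·Ω(V/K, ω_V)·C(V/K, ω_V)/#V(K)_tors² = RHS(W)·RHS(Wd)` with Dokchitser–Dokchitser's
  modified Tamagawa product `C(V/K, ω_V) = V.modifiedTamagawaProduct` (Ann. of Math. 172 (2010), §1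
  Notation: `C(E/K) = ∏_{v∤∞} c_v |ω/ω_v°|_v`);
* `Literature.NumberTheory.EllipticCurves.Milne1972.bsdQuotient_baseChange_quadratic` (registry A65):
  the same for a GLOBALLY MINIMAL `K`-model `W'`, with the plain Tamagawa product
  `W'.tamagawaProduct`.

The module docstring of the any-model file says: *"For a globally minimal `V` every
`|ω_V/ω_v°|_v = 1` and the statement is `bsdQuotient_baseChange_quadratic`."* This file PROVES that
sentence, so that the second fact is a corollary BY NAME of the first (one print dependence — Milne,
Invent. Math. 17 (1972) §1 Thm. 1 / §2 Prop. 6–7 through Dokchitser–Dokchitser 2010 §2.1 — for both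
binders):

* `WeierstrassCurve.localTamagawaFactor_eq_localTamagawaNumber_of_isMinimalAt` — at a finite place
  `w` where the model `X` is minimal, Dokchitser–Dokchitser's local factor is the Tamagawa number:
  `C_w(X) = c_w(X)` (the exponent `k_w = (ord_w Δ_X − ord_w Δ_min)/12` vanishes by the tree theorem
  `WeierstrassCurve.valuation_Δ_eq_of_isMinimalAt_holds`, Silverman *AEC* VII.1 Prop. 1.3; i.e. the
  invariant differential of a `w`-minimal equation is a Néron differential at `w`). The same three-line
  argument is used Summits-side in `Rank1Residual/Additive/CyclotomicThreeMultiplicativeReduction.lean`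
  (`localTamagawaFactor_eq_of_isMinimalAt`); it is re-proved here because Literature cannot import
  Summits.
* `WeierstrassCurve.modifiedTamagawaProduct_eq_tamagawaProduct_of_isGloballyMinimal` — for a globally
  minimal model, `C(X/K, ω_X) = ∏_w c_w(X)` (as rational numbers): Dokchitser–Dokchitser's remark that
  all corrections `|ω/ω_v°|_v` are `1` for a Néron differential (`IsGloballyMinimal.isMinimalAt` at
  every `w`, then `Nat.cast_finprod'`).
* `Literature.NumberTheory.EllipticCurves.Milne1972.bsdQuotient_baseChange_quadratic_of_anyModel` —
  **A73 ⇒ A65**: specialise the any-model fact to `V = W'` and rewrite `C(W'/K, ω_{W'}) = ∏_w c_w(W')`.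
* `WeierstrassCurve.bsdRHS_baseChange_quadratic_of_bsdQuotient` — **A65 ⇒ the rank-zero imaginary
  sibling `WeierstrassCurve.bsdRHS_baseChange_quadratic`** (`BSDQuadraticDescent.lean`; the leaf `hBC`
  of the Burungale–Flach CM assembly `bsdTriple_of_j_mem_maximalCMJInvariants_of_L_one_ne_zero_of_eleven_leaves`):
  that sibling assumes `E(K)` finite and `Ш(E_K/K)` finite (instead of `Ш(E/ℚ)`, `Ш(E^{(d_K)}/ℚ)`);
  the tree's quadratic descent of finiteness `WeierstrassCurve.shaFinite_of_shaFinite_smul_baseChange`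
  / `shaFinite_twist_of_shaFinite_smul_baseChange` (`BSDQuadraticDescentTorsionOddPartProofs`;
  Darmon 2004 §3.9) supplies the two finiteness hypotheses of A65, and in rank `0` the regulator is
  `1` (`WeierstrassCurve.regulator_eq_one_of_finite`) and `#E(K)_tors = #E(K)`
  (`WeierstrassCurve.torsionOrder_eq_natCard_of_finite`). Composite
  `WeierstrassCurve.bsdRHS_baseChange_quadratic_of_anyModel` — **A73 ⇒ A65 ⇒ sibling**: all three
  Milne–Dokchitser binders of the tree carry ONE print dependence.

## References

* J. S. Milne, *On the arithmetic of abelian varieties*, Invent. Math. 17 (1972) 177–190, §1 Thm. 1,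
  §2 Prop. 6 (a), Prop. 7 and Example 1 (p. 185). [Milne1972ArithmeticAV]
* T. Dokchitser, V. Dokchitser, *On the Birch–Swinnerton-Dyer quotients modulo squares*, Ann. of
  Math. 172 (2010) 567–596 = arXiv:math/0610290, §1 Notation (arXiv pp. 4–5), §2.1.
  [DokchitserDokchitserAnnals2010]
* J. H. Silverman, *The Arithmetic of Elliptic Curves*, 2nd ed. (2009), VII.1 Prop. 1.3, VIII.8.
  [SilvermanAEC2009]

## Design

Theorems only (D-0026); imports `ComplexMultiplicationBurungaleFlachProofs` only for the namespace
conventions of the BSD-invariant glue (no use of its CM content), `EllArithGlue` for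
`IsGloballyMinimal.isMinimalAt`, `MinimalDiscriminantNormProofs` for
`valuation_Δ_eq_of_isMinimalAt_holds`. `noncomputable section`, `open scoped Classical` as in the
topic.
-/

noncomputable section

open scoped Classical
open IsDedekindDomain NumberField

namespace WeierstrassCurve

variable {K : Type*} [Field K] [NumberField K]

/-- **`C_w(X) = c_w(X)` at a finite place `w` where the Weierstrass model `X` is minimal**:
Dokchitser–Dokchitser's local factor `c_w · |ω_X/ω_w°|_w` (`WeierstrassCurve.localTamagawaFactor`)
reduces to the local Tamagawa number, because the exponent
`k_w = (ord_w Δ_X − ord_w Δ_min,w)/12` (`WeierstrassCurve.neronExponent`) is `0` when `X` is minimal at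
`w` (`ord_w Δ_X = ord_w Δ_min`, tree theorem `valuation_Δ_eq_of_isMinimalAt_holds`; Silverman, *AEC*,
VII.1 Prop. 1.3 — the differential of a minimal equation is a Néron differential at `w`).
[cite: DokchitserDokchitserAnnals2010, §1 Notation (arXiv pp. 4–5)] -/
theorem localTamagawaFactor_eq_localTamagawaNumber_of_isMinimalAt (X : WeierstrassCurve K)
    [X.IsElliptic] (w : HeightOneSpectrum (𝓞 K)) (hmin : X.IsMinimalAt w) :
    X.localTamagawaFactor w =
      ((X.baseChange (w.adicCompletion K)).localTamagawaNumber (w.adicCompletionIntegers K) : ℚ) := by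
  have h := valuation_Δ_eq_of_isMinimalAt_holds (v := w) (W := X) hmin
  rw [localTamagawaFactor_def, WeierstrassCurve.neronExponent, h, WithZero.log_exp]
  simp

/-- **For a GLOBALLY MINIMAL model the modified Tamagawa product is the Tamagawa product**:
`C(X/K, ω_X) = ∏_{w∤∞} c_w |ω_X/ω_w°|_w = ∏_{w∤∞} c_w(X)` in `ℚ`, since `ω_X` is a Néron differential
at every finite place (`IsGloballyMinimal.isMinimalAt`, previous theorem placewise, and
`Nat.cast_finprod'` to move the cast `ℕ → ℚ` through the `finprod`). This is the sentence
*"all corrections `1` for a model whose differential is a Néron differential at every finite place,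
e.g. a globally minimal model"* of the docstrings of `Milne1972/WeilRestrictionQuadraticBSDQuotient*`.
[cite: DokchitserDokchitserAnnals2010, §1 Notation (arXiv pp. 4–5)] -/
theorem modifiedTamagawaProduct_eq_tamagawaProduct_of_isGloballyMinimal (X : WeierstrassCurve K)
    [X.IsElliptic] [X.IsGloballyMinimal] :
    X.modifiedTamagawaProduct = (X.tamagawaProduct : ℚ) := by
  rw [modifiedTamagawaProduct_def, tamagawaProduct, Nat.cast_finprod']
  exact finprod_congr fun w =>
    X.localTamagawaFactor_eq_localTamagawaNumber_of_isMinimalAt w (IsGloballyMinimal.isMinimalAt X w)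

end WeierstrassCurve

namespace Literature.NumberTheory.EllipticCurves.Milne1972

open WeierstrassCurve

/-- **A73 ⇒ A65 (the globally-minimal-model statement is the any-model statement specialised).**
Milne's Weil-restriction identity for a quadratic base change on an ARBITRARY `K`-model
(`bsdQuotient_baseChange_quadratic_anyModel`, with Dokchitser–Dokchitser's
`C(V/K, ω_V) = V.modifiedTamagawaProduct`) implies the same identity on a globally minimal `K`-model
`W'` with the plain Tamagawa product (`bsdQuotient_baseChange_quadratic`): take `V = W'` and use
`W'.modifiedTamagawaProduct = W'.tamagawaProduct`
(`WeierstrassCurve.modifiedTamagawaProduct_eq_tamagawaProduct_of_isGloballyMinimal`). Hence the two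
named facts of this story carry ONE print dependence (Milne, Invent. Math. 17 (1972) §1 Thm. 1 and
§2 Prop. 6 (a) / Prop. 7 / Example 1 p. 185, through Dokchitser–Dokchitser, Ann. of Math. 172 (2010)
§2.1). Nothing is asserted: this is an implication between two `Prop`s.
[cite: Milne1972ArithmeticAV, §1 Thm. 1 and §2 Prop. 6 (a), Prop. 7 (through DokchitserDokchitserAnnals2010, §2.1, proof of Thm. 2.3)] -/
theorem bsdQuotient_baseChange_quadratic_of_anyModel (h : bsdQuotient_baseChange_quadratic_anyModel) :
    bsdQuotient_baseChange_quadratic := by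
  intro W _ _ K _ _ h2 Wd _ _ hWd W' _ _ hW' hW hD
  obtain ⟨hsha, heq⟩ := h W K h2 Wd hWd W' hW' hW hD
  refine ⟨hsha, ?_⟩
  rw [W'.modifiedTamagawaProduct_eq_tamagawaProduct_of_isGloballyMinimal, Rat.cast_natCast] at heq
  exact heq

end Literature.NumberTheory.EllipticCurves.Milne1972

namespace WeierstrassCurve

open Literature.NumberTheory.EllipticCurves Literature.NumberTheory.EllipticCurves.Milne1972

/-- **A65 ⇒ the rank-zero imaginary-quadratic sibling `WeierstrassCurve.bsdRHS_baseChange_quadratic`.**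
Milne's Weil-restriction identity on a globally minimal `K`-model `W'`
(`Milne1972.bsdQuotient_baseChange_quadratic`) implies the rank-zero form used by the Burungale–Flach CM
road: if `E(K)` is finite and `Ш(E_K/K)` is finite then
`Ω(E_K/K)·#Ш(W')·∏_w c_w(W')/#W'(K)² = RHS(W)·RHS(Wd)`. The hypotheses `Ш(W)`, `Ш(Wd)` finite of the
any-rank fact follow from `Ш(W')` finite by the tree's quadratic descent of finiteness
(`shaFinite_of_shaFinite_smul_baseChange`, `shaFinite_twist_of_shaFinite_smul_baseChange`; Darmon 2004
§3.9 — `Ш(E/ℚ) → Ш(E/K)` has finite kernel), and in rank zero `Reg(W') = 1`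
(`regulator_eq_one_of_finite`) and `#W'(K)_tors = #W'(K)` (`torsionOrder_eq_natCard_of_finite`).
Nothing is asserted: an implication between two `Prop`s (the total-complexity hypothesis of the
sibling is not even used). [cite: Milne1972ArithmeticAV, §1 Thm. 1 and §2 Prop. 6 (a), Prop. 7 (through DokchitserDokchitserAnnals2010, §2.1, proof of Thm. 2.3)] -/
theorem bsdRHS_baseChange_quadratic_of_bsdQuotient (h : bsdQuotient_baseChange_quadratic) :
    bsdRHS_baseChange_quadratic := by
  intro W _ _ K _ _ _ h2 Wd _ _ hWd W' _ _ hW' hfin hsha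
  obtain ⟨Cd, hCd⟩ := hWd
  obtain ⟨C', hC'⟩ := hW'
  have hW : W.ShaFinite := W.shaFinite_of_shaFinite_smul_baseChange K hC' hsha
  have hD : Wd.ShaFinite := W.shaFinite_twist_of_shaFinite_smul_baseChange K h2 hCd hC' hsha
  haveI : Finite W'.toAffine.Point := hfin
  obtain ⟨-, heq⟩ := h W K h2 Wd ⟨Cd, hCd⟩ W' ⟨C', hC'⟩ hW hD
  rw [W'.regulator_eq_one_of_finite, W'.torsionOrder_eq_natCard_of_finite, mul_one] at heq
  rw [← heq]
  ring

/-- **A73 ⇒ the rank-zero sibling** (composite of `Milne1972.bsdQuotient_baseChange_quadratic_of_anyModel`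
and `bsdRHS_baseChange_quadratic_of_bsdQuotient`): the leaf `hBC` of the Burungale–Flach CM assembly is a
corollary BY NAME of Milne's any-model identity.
[cite: Milne1972ArithmeticAV, §1 Thm. 1 and §2 Prop. 6 (a), Prop. 7 (through DokchitserDokchitserAnnals2010, §2.1, proof of Thm. 2.3)] -/
theorem bsdRHS_baseChange_quadratic_of_anyModel (h : bsdQuotient_baseChange_quadratic_anyModel) :
    bsdRHS_baseChange_quadratic :=
  bsdRHS_baseChange_quadratic_of_bsdQuotient (bsdQuotient_baseChange_quadratic_of_anyModel h)

end WeierstrassCurve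

end
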